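import Mathlib
import Summits.BirchSwinnertonDyer.BirchSwinnertonDyer.Theorems.ResidualThetaTransportAtTwoSignedMuSeedAtTwoPlusNonsquareDescentHerbrandIndex
import HarnessLib

/-!
# Non-square descent — THE HILBERT-90 DESCENT `H¹(G, A) ≅ (B/A)^G / im B^G` for `A ≤ B` with `Ĥ⁻¹(G, B) = 0`
# («`H¹(G, E_m) ≅ P_m^G/P_n`», the capitulation half of stub S2's residue «`[𝓔_n^χ : 𝒩_n] ≤ #F^χ`» of line `nonsquare-descent`) —
# seed crux `SignedMuSeedAtTwoPlus` stmt-BirchSwinnertonDyer-21438 (parent Kμ⁺ `SignedMuVanishingAtTwoPlus` stmt-BirchSwinnertonDyer-20689,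
# route ResidualThetaTransportAtTwo), line card `Cruxes/SignedMuSeedAtTwoPlus/Lines/nonsquare-descent.md`

Cell `bsd-wall`, width seat `bsd-wall-rtt-p4-w2` g19 (`--supports`, closes nothing).  THEOREMS ONLY; BSD is not proved by this and nothing
arithmetic is asserted: module algebra over a commutative ring `R` with two scalars `ω ν` (`σ − 1` and the norm element of a cyclic
`G = ⟨σ⟩`), in the index currency `Herbrand.index T S = |T/(S ∩ T)|` of `Literature.Algebra.Homology.HerbrandQuotientEndomorphisms`.

Stub S2 of the card bounds «units modulo universal norms» through `[𝓔_n^χ : N_{m,n}𝓔_m^χ] = #H¹(G_{m,n}, 𝓔_m^χ)` (Herbrand quotient `1`: the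
companion file `…HerbrandIndex`, `index_torsionBy_smul_top_eq`) and «`H¹(G, E_m) ≅ P_m^G/P_n` (Hilbert 90), the ramified-prime term Δ-trivial,
capitulation `≤ #F^χ`».  THIS FILE is the Hilbert-90 step as module algebra.  Dictionary (nothing below depends on it): `B` = `M_m^×` (tensored
with `𝒪`, `χ`-part), a `Λ'/ω_m`-module, so killed by `ν ω` (`hB`); `A ≤ B` the units; `B ⧸ A` = principal ideals `P_m`; HILBERT 90 in Tate form
`Ĥ⁻¹(G, B) = 0` is «an element of norm `1` is `σb/b`»: `B[ν] ≤ ωB` (`h90`); `G`-invariants are `ω`-torsion, so `(B ⧸ A)[ω] = P_m^G`, and the image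
of `B[ω] = (M_n^×)` in it is `P_n`; `H¹(G, A) = Ĥ⁻¹(G, A) = A[ν]/ωA` (cyclic `G`).  Then (`Nat.card`, unconditional — no finiteness needed):

  **`(A ∩ B[ν] : ωA) = ((B ⧸ A)[ω] : im B[ω])`**  (`index_inf_torsionBy_smul_eq_index_torsionBy_quotient`) — «`#H¹(G, E_m) = [P_m^G : P_n]`»,

through the submodule `P̃ = {b | ω b ∈ A} = mkQ⁻¹((B ⧸ A)[ω]) ⊇ A + B[ω]` and the connecting map `b ↦ ω b : P̃ ↠ (A ∩ B[ν])/ωA` (onto by `h90`,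
kernel `A + B[ω]`); composed with `…HerbrandIndex`: **`(A[ω] : νA) = ((B ⧸ A)[ω] : im B[ω])`** for `A` containing a free cyclic `R∙u` (annihilator
exactly `(ν ω)`) of finite index (`index_invariants_norms_eq_index_torsionBy_quotient`) — «`[𝓔_n^χ : N_{m,n}𝓔_m^χ] = [P_m^{G,χ} : P_n^χ]`».

* §1 transport of indices along a linear map `φ`: `card_map_eq_index_ker` (`|φT| = (T : ker φ)`), **`index_map_map_eq`** (`(φT : φS) = (T : S + ker φ)`),
  `index_map_map_eq_of_injective`, `index_comap_subtype` (indices computed inside `↥A` are ambient indices), `torsionBy_submodule_eq_comap`,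
  `smul_top_submodule_eq_comap`, `index_torsionBy_smul_top_submodule` (`(A[ω] : νA)` in `↥A` = `(A ∩ B[ω] : νA)` in `B`).
* §2 `P̃`: `sup_torsionBy_le_comap_lsmul`, `comap_lsmul_eq_comap_mkQ_torsionBy`, `map_mkQ_comap_lsmul` (`mkQ P̃ = (B ⧸ A)[ω]`),
  `index_comap_lsmul_eq_index_torsionBy_quotient` (`(P̃ : A + B[ω]) = ((B ⧸ A)[ω] : im B[ω])`).
* §3 the descent: `lsmul_mem_inf_torsionBy`, **`index_inf_torsionBy_smul_eq_index_comap_lsmul`** (`(A ∩ B[ν] : ωA) = (P̃ : A + B[ω])`, via the connecting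
  map), and the two displayed consequences (+ `index_torsionBy_submodule_eq_index_torsionBy_quotient`, the `↥A`-currency form).

General-purpose (candidate for re-homing under `Literature/Algebra/Homology` by a librarian).  [folklore]
-/

set_option autoImplicit false
-- the Theorems namespace of this sub repeats the summit name by design (D-0017 nested layout)
set_option linter.dupNamespace false

open scoped Pointwise nonZeroDivisors
open Literature.Algebra.Homology

namespace Summit.BirchSwinnertonDyer.BirchSwinnertonDyer.Theorems.SignedMuAtTwo.NonsquareDescent

variable {R : Type*} [CommRing R] {B : Type*} [AddCommGroup B] [Module R B] {N : Type*} [AddCommGroup N] [Module R N]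

/-! ## §1 Transport of indices along a linear map -/

/-- **`|φ(T)| = (T : ker φ)`** (`φ` restricted to `T` has image `φ(T)` and kernel `T ∩ ker φ`). [folklore] -/
theorem card_map_eq_index_ker (φ : B →ₗ[R] N) (T : Submodule R B) :
    Nat.card (T.map φ) = Herbrand.index T (LinearMap.ker φ) := by
  have hker : LinearMap.ker (φ ∘ₗ T.subtype) = (LinearMap.ker φ).comap T.subtype := LinearMap.ker_comp _ _
  have hrange : LinearMap.range (φ ∘ₗ T.subtype) = T.map φ := by
    rw [LinearMap.range_comp, Submodule.range_subtype]
  rw [Herbrand.index, ← hker, ← Nat.card_congr (LinearEquiv.ofEq _ _ hrange).toEquiv]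
  exact (Nat.card_congr (LinearMap.quotKerEquivRange (φ ∘ₗ T.subtype)).toEquiv).symm

/-- **`(φT : φS) = (T : S + ker φ)`** for any linear map `φ` and any submodules `T`, `S` (`Nat.card`, unconditional). [folklore] -/
theorem index_map_map_eq (φ : B →ₗ[R] N) (T S : Submodule R B) :
    Herbrand.index (T.map φ) (S.map φ) = Herbrand.index T (S ⊔ LinearMap.ker φ) := by
  rw [Herbrand.index_eq_card_map_mkQ, ← Submodule.map_comp, card_map_eq_index_ker, LinearMap.ker_comp,
    Submodule.ker_mkQ, Submodule.comap_map_eq]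

/-- `(φT : φS) = (T : S)` for `φ` injective. [folklore] -/
theorem index_map_map_eq_of_injective (φ : B →ₗ[R] N) (hφ : Function.Injective φ) (T S : Submodule R B) :
    Herbrand.index (T.map φ) (S.map φ) = Herbrand.index T S := by
  rw [index_map_map_eq, LinearMap.ker_eq_bot.2 hφ, sup_bot_eq]

/-- Indices computed inside a submodule `A` are ambient indices: `(T ∩ A : S ∩ A)_{↥A} = (A ∩ T : A ∩ S)`. [folklore] -/
theorem index_comap_subtype (A T S : Submodule R B) :
    Herbrand.index (T.comap A.subtype) (S.comap A.subtype) = Herbrand.index (A ⊓ T) (A ⊓ S) := by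
  rw [← index_map_map_eq_of_injective A.subtype A.injective_subtype, Submodule.map_comap_subtype,
    Submodule.map_comap_subtype]

/-- The `ω`-torsion of `↥A` is `A ∩ B[ω]` pulled back. [folklore] -/
theorem torsionBy_submodule_eq_comap (A : Submodule R B) (ω : R) :
    Submodule.torsionBy R A ω = (Submodule.torsionBy R B ω).comap A.subtype := by
  ext x
  rw [Submodule.mem_torsionBy_iff, Submodule.mem_comap, Submodule.subtype_apply, Submodule.mem_torsionBy_iff,
    ← Submodule.coe_eq_zero, Submodule.coe_smul]

/-- `ν • ⊤` in `↥A` is `νA` pulled back. [folklore] -/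
theorem smul_top_submodule_eq_comap (A : Submodule R B) (ν : R) :
    (ν • (⊤ : Submodule R A)) = (ν • A).comap A.subtype := by
  ext x
  simp only [Submodule.mem_smul_pointwise_iff_exists, Submodule.mem_comap, Submodule.subtype_apply, Submodule.mem_top,
    true_and]
  constructor
  · rintro ⟨y, rfl⟩
    exact ⟨y, y.2, by rw [Submodule.coe_smul]⟩
  · rintro ⟨b, hb, hbx⟩
    exact ⟨⟨b, hb⟩, Subtype.ext (by rw [Submodule.coe_smul]; exact hbx)⟩

/-- **`(A[ω] : νA)` computed in `↥A` is `(A ∩ B[ω] : νA)` computed in `B`** — so `…HerbrandIndex` (stated for a module `E`) applies to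
`E = ↥A` for a submodule `A ≤ B`. [folklore] -/
theorem index_torsionBy_smul_top_submodule (A : Submodule R B) (ω ν : R) :
    Herbrand.index (Submodule.torsionBy R A ω) (ν • (⊤ : Submodule R A)) =
      Herbrand.index (A ⊓ Submodule.torsionBy R B ω) (ν • A) := by
  rw [torsionBy_submodule_eq_comap, smul_top_submodule_eq_comap, index_comap_subtype,
    inf_eq_right.2 (Submodule.smul_le_self_of_tower ν A)]

/-! ## §2 The submodule `P̃ = {b | ω b ∈ A} = mkQ⁻¹((B ⧸ A)[ω])` -/

/-- `A + B[ω] ≤ P̃`. [folklore] -/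
theorem sup_torsionBy_le_comap_lsmul (A : Submodule R B) (ω : R) :
    A ⊔ Submodule.torsionBy R B ω ≤ A.comap (DistribSMul.toLinearMap R B ω) := by
  refine sup_le ?_ ?_
  · intro a ha
    rw [Submodule.mem_comap, DistribSMul.toLinearMap_apply]
    exact A.smul_mem ω ha
  · intro b hb
    rw [Submodule.mem_torsionBy_iff] at hb
    rw [Submodule.mem_comap, DistribSMul.toLinearMap_apply, hb]
    exact A.zero_mem

/-- `P̃ = mkQ⁻¹((B ⧸ A)[ω])` («the classes fixed by `G`»). [folklore] -/
theorem comap_lsmul_eq_comap_mkQ_torsionBy (A : Submodule R B) (ω : R) :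
    A.comap (DistribSMul.toLinearMap R B ω) = (Submodule.torsionBy R (B ⧸ A) ω).comap A.mkQ := by
  ext b
  rw [Submodule.mem_comap, DistribSMul.toLinearMap_apply, Submodule.mem_comap, Submodule.mem_torsionBy_iff,
    Submodule.mkQ_apply, ← Submodule.Quotient.mk_smul, Submodule.Quotient.mk_eq_zero]

/-- `mkQ(P̃) = (B ⧸ A)[ω]`. [folklore] -/
theorem map_mkQ_comap_lsmul (A : Submodule R B) (ω : R) :
    (A.comap (DistribSMul.toLinearMap R B ω)).map A.mkQ = Submodule.torsionBy R (B ⧸ A) ω := by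
  rw [comap_lsmul_eq_comap_mkQ_torsionBy, Submodule.map_comap_eq_of_surjective (Submodule.mkQ_surjective A)]

/-- **`(P̃ : A + B[ω]) = ((B ⧸ A)[ω] : im B[ω])`** («`= [P_m^G : P_n]`»). [folklore] -/
theorem index_comap_lsmul_eq_index_torsionBy_quotient (A : Submodule R B) (ω : R) :
    Herbrand.index (A.comap (DistribSMul.toLinearMap R B ω)) (A ⊔ Submodule.torsionBy R B ω) =
      Herbrand.index (Submodule.torsionBy R (B ⧸ A) ω) ((Submodule.torsionBy R B ω).map A.mkQ) := by
  rw [← map_mkQ_comap_lsmul, index_map_map_eq, Submodule.ker_mkQ, sup_comm]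

/-! ## §3 The descent: the connecting map `b ↦ ω b : P̃ ↠ (A ∩ B[ν])/ωA` -/

section Descent

variable {ω ν : R}

/-- `ω` maps `P̃` into `A ∩ B[ν]` when `ν ω` kills `B`. [folklore] -/
theorem lsmul_mem_inf_torsionBy (hB : ∀ b : B, (ν * ω) • b = 0) {A : Submodule R B} {b : B}
    (hb : b ∈ A.comap (DistribSMul.toLinearMap R B ω)) : ω • b ∈ A ⊓ Submodule.torsionBy R B ν := by
  rw [Submodule.mem_comap, DistribSMul.toLinearMap_apply] at hb
  exact Submodule.mem_inf.2 ⟨hb, by rw [Submodule.mem_torsionBy_iff, smul_smul, hB]⟩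

/-- **THE HILBERT-90 DESCENT `(A ∩ B[ν] : ωA) = (P̃ : A + B[ω])`**: for `B` killed by `ν ω` with `B[ν] ≤ ωB` (Hilbert 90 in Tate form,
`Ĥ⁻¹(G, B) = 0`) and any submodule `A`, the connecting map `b ↦ ω b` induces `P̃/(A + B[ω]) ≃ (A ∩ B[ν])/ωA` — it is onto by Hilbert 90 and
its kernel is `A + B[ω]`.  («`H¹(G, A) ≅ (B/A)^G / im B^G`».) [folklore] -/
theorem index_inf_torsionBy_smul_eq_index_comap_lsmul (hB : ∀ b : B, (ν * ω) • b = 0)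
    (h90 : Submodule.torsionBy R B ν ≤ ω • (⊤ : Submodule R B)) (A : Submodule R B) :
    Herbrand.index (A ⊓ Submodule.torsionBy R B ν) (ω • A) =
      Herbrand.index (A.comap (DistribSMul.toLinearMap R B ω)) (A ⊔ Submodule.torsionBy R B ω) := by
  set P := A.comap (DistribSMul.toLinearMap R B ω) with hP
  set T := A ⊓ Submodule.torsionBy R B ν with hT
  set δ : P →ₗ[R] T := LinearMap.codRestrict T ((DistribSMul.toLinearMap R B ω) ∘ₗ P.subtype)
    (fun x => lsmul_mem_inf_torsionBy hB x.2) with hδ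
  have hδ_apply : ∀ x : P, (δ x : B) = ω • (x : B) := fun x => rfl
  set Ψ : P →ₗ[R] T ⧸ (ω • A).comap T.subtype := ((ω • A).comap T.subtype).mkQ ∘ₗ δ with hΨ
  have hΨsurj : Function.Surjective Ψ := by
    intro q
    obtain ⟨t, rfl⟩ := Submodule.mkQ_surjective _ q
    have ht : (t : B) ∈ ω • (⊤ : Submodule R B) := h90 (Submodule.mem_inf.1 t.2).2
    rw [Submodule.mem_smul_pointwise_iff_exists] at ht
    obtain ⟨c, -, hc⟩ := ht
    have hcP : c ∈ P := by
      rw [hP, Submodule.mem_comap, DistribSMul.toLinearMap_apply, hc]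
      exact (Submodule.mem_inf.1 t.2).1
    refine ⟨⟨c, hcP⟩, ?_⟩
    rw [hΨ, LinearMap.comp_apply]
    congr 1
    exact Subtype.ext hc
  have hker : LinearMap.ker Ψ = (A ⊔ Submodule.torsionBy R B ω).comap P.subtype := by
    ext x
    rw [LinearMap.mem_ker, hΨ, LinearMap.comp_apply, Submodule.mkQ_apply, Submodule.Quotient.mk_eq_zero,
      Submodule.mem_comap, Submodule.subtype_apply, hδ_apply, Submodule.mem_comap, Submodule.subtype_apply,
      Submodule.mem_smul_pointwise_iff_exists, Submodule.mem_sup]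
    constructor
    · rintro ⟨a, ha, hax⟩
      refine ⟨a, ha, (x : B) - a, ?_, add_sub_cancel a (x : B)⟩
      rw [Submodule.mem_torsionBy_iff, smul_sub, hax, sub_self]
    · rintro ⟨a, ha, z, hz, hx⟩
      rw [Submodule.mem_torsionBy_iff] at hz
      exact ⟨a, ha, by rw [← hx, smul_add, hz, add_zero]⟩
  rw [Herbrand.index, Herbrand.index, ← hker]
  exact (Nat.card_congr (LinearMap.quotKerEquivOfSurjective Ψ hΨsurj).toEquiv).symm

/-- **`(A ∩ B[ν] : ωA) = ((B ⧸ A)[ω] : im B[ω])`** — «`#H¹(G, E_m) = [P_m^G : P_n]`» (`B` killed by `ν ω`, Hilbert 90 `B[ν] ≤ ωB`; `Nat.card`,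
no finiteness needed). [folklore] -/
theorem index_inf_torsionBy_smul_eq_index_torsionBy_quotient (hB : ∀ b : B, (ν * ω) • b = 0)
    (h90 : Submodule.torsionBy R B ν ≤ ω • (⊤ : Submodule R B)) (A : Submodule R B) :
    Herbrand.index (A ⊓ Submodule.torsionBy R B ν) (ω • A) =
      Herbrand.index (Submodule.torsionBy R (B ⧸ A) ω) ((Submodule.torsionBy R B ω).map A.mkQ) := by
  rw [index_inf_torsionBy_smul_eq_index_comap_lsmul hB h90 A, index_comap_lsmul_eq_index_torsionBy_quotient]

/-- The same with the left side computed inside `↥A`: `(A[ν] : ωA)_{↥A} = ((B ⧸ A)[ω] : im B[ω])`. [folklore] -/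
theorem index_torsionBy_submodule_eq_index_torsionBy_quotient (hB : ∀ b : B, (ν * ω) • b = 0)
    (h90 : Submodule.torsionBy R B ν ≤ ω • (⊤ : Submodule R B)) (A : Submodule R B) :
    Herbrand.index (Submodule.torsionBy R A ν) (ω • (⊤ : Submodule R A)) =
      Herbrand.index (Submodule.torsionBy R (B ⧸ A) ω) ((Submodule.torsionBy R B ω).map A.mkQ) := by
  rw [index_torsionBy_smul_top_submodule, index_inf_torsionBy_smul_eq_index_torsionBy_quotient hB h90 A]

/-- **UNITS MODULO NORMS = INVARIANT CLASSES MODULO CLASSES FROM BELOW: `(A[ω] : νA) = ((B ⧸ A)[ω] : im B[ω])`** — the composition with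
`…HerbrandIndex`: for `B` killed by `ν ω` (`ω`, `ν` non-zero-divisors) with `B[ν] ≤ ωB` (Hilbert 90), and a submodule `A` containing `u` with
annihilator EXACTLY `(ν ω)` (S1: free cyclic Robert system) with `A ⧸ R∙u` finite (S1: finite index):
«`[𝓔_n^χ : N_{m,n}𝓔_m^χ] = #H¹(G_{m,n}, 𝓔_m^χ) = [P_m^{G} : P_n]`» (on `χ`-parts). [folklore] -/
theorem index_invariants_norms_eq_index_torsionBy_quotient (hω : ω ∈ R⁰) (hν : ν ∈ R⁰) (hB : ∀ b : B, (ν * ω) • b = 0)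
    (h90 : Submodule.torsionBy R B ν ≤ ω • (⊤ : Submodule R B)) (A : Submodule R B) {u : A}
    (hu : ∀ r : R, r • u = 0 → ν * ω ∣ r) [Finite (A ⧸ Submodule.span R {u})] :
    Herbrand.index (Submodule.torsionBy R A ω) (ν • (⊤ : Submodule R A)) =
      Herbrand.index (Submodule.torsionBy R (B ⧸ A) ω) ((Submodule.torsionBy R B ω).map A.mkQ) := by
  have hA : ∀ x : A, (ν * ω) • x = 0 := fun x => Subtype.ext (by rw [Submodule.coe_smul, Submodule.coe_zero, hB])
  rw [index_torsionBy_smul_top_eq hω hν hA hu]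
  exact index_torsionBy_submodule_eq_index_torsionBy_quotient hB h90 A

/-- … and then `((B ⧸ A)[ω] : im B[ω])` is FINITE (`≠ 0`): «`P_m^{G,χ}/P_n^χ` is finite». [folklore] -/
theorem index_torsionBy_quotient_ne_zero (hω : ω ∈ R⁰) (hν : ν ∈ R⁰) (hB : ∀ b : B, (ν * ω) • b = 0)
    (h90 : Submodule.torsionBy R B ν ≤ ω • (⊤ : Submodule R B)) (A : Submodule R B) {u : A}
    (hu : ∀ r : R, r • u = 0 → ν * ω ∣ r) [Finite (A ⧸ Submodule.span R {u})] :
    Herbrand.index (Submodule.torsionBy R (B ⧸ A) ω) ((Submodule.torsionBy R B ω).map A.mkQ) ≠ 0 := by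
  have hA : ∀ x : A, (ν * ω) • x = 0 := fun x => Subtype.ext (by rw [Submodule.coe_smul, Submodule.coe_zero, hB])
  rw [← index_invariants_norms_eq_index_torsionBy_quotient hω hν hB h90 A hu]
  exact index_torsionBy_smul_top_ne_zero hω hA hu

end Descent

end Summit.BirchSwinnertonDyer.BirchSwinnertonDyer.Theorems.SignedMuAtTwo.NonsquareDescent
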